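import Mathlib
import Literature.NumberTheory.Transcendental.SemialgebraicMapsProofs

/-!
# The inverse of an injective semialgebraic map is semialgebraic

Helper for the line `separating-pencil-trace` of the crux
`Summit.KontsevichZagierPeriods.KontsevichZagierPeriods.Theses.HermiteRigidity.GenusTwoCycleTransfer`:
each oval integral is pushed forward along an explicit injective `ℚ`-semialgebraic map, and the
push-forward integrand is composed with the inverse of that map. This file supplies the
semialgebraic-geometry input (Bochnak–Coste–Roy 1998, §2.2): the inverse `Function.invFunOn Φ σ`
of a `ℚ`-semialgebraic map `Φ` on `σ ⊆ ℝ ^ m` which is injective on `σ` is a `ℚ`-semialgebraic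
map on the image `Φ '' σ`. Indeed its graph over `Φ '' σ` is `{(Φ x, x) | x ∈ σ} ⊆ ℝ ^ (n + m)`,
the image of the graph `{(x, Φ x) | x ∈ σ} ⊆ ℝ ^ (m + n)` of `Φ` under the coordinate block swap
`w ↦ w ∘ θ`, and images of semialgebraic sets under coordinate maps are semialgebraic
(`Literature.ModelTheory.ExponentialFields.IsSemialgebraic.image_comp`, a consequence of
Tarski–Seidenberg).

## References

* J. Bochnak, M. Coste, M.-F. Roy, *Real Algebraic Geometry*, Ergebnisse 36, Springer (1998),
  §2.2 (Def. 2.2.5, Prop. 2.2.7).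
-/

noncomputable section

open Set

open Literature.NumberTheory.Transcendental Literature.ModelTheory.ExponentialFields

namespace Summit.KontsevichZagierPeriods.HermiteRigidity.GenusTwoCycleTransfer

/-- **The inverse of an injective semialgebraic map is a semialgebraic map.** If `Φ` is a
`ℚ`-semialgebraic map on `σ ⊆ ℝ ^ m` which is injective on `σ`, then `Function.invFunOn Φ σ` is a
`ℚ`-semialgebraic map on `Φ '' σ`: since `Function.invFunOn Φ σ (Φ x) = x` for `x ∈ σ`, its graph
over `Φ '' σ` is `{(Φ x, x) | x ∈ σ} ⊆ ℝ ^ (n + m)`, the image of the graph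
`{(x, Φ x) | x ∈ σ} ⊆ ℝ ^ (m + n)` of `Φ` under the coordinate block swap `w ↦ w ∘ θ`,
`θ = Fin.append natAdd castAdd`, hence semialgebraic (`IsSemialgebraic.image_comp`).
[cite: BochnakCosteRoy1998, §2.2] -/
theorem stub_semialgebraicInvFunOn {m n : ℕ} {σ : Set (Fin m → ℝ)}
    {Φ : (Fin m → ℝ) → (Fin n → ℝ)} (hΦ : IsSemialgebraicMapOn ℚ σ Φ) (hinj : InjOn Φ σ) :
    IsSemialgebraicMapOn ℚ (Φ '' σ) (Function.invFunOn Φ σ) := by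
  -- block swap: `θ (castAdd m j) = natAdd m j`, `θ (natAdd n i) = castAdd n i`
  set θ : Fin (n + m) → Fin (m + n) :=
    Fin.append (fun j : Fin n => Fin.natAdd m j) (fun i : Fin m => Fin.castAdd n i) with hθ
  have hθ₁ : ∀ j : Fin n, θ (Fin.castAdd m j) = Fin.natAdd m j := fun j => by simp [hθ]
  have hθ₂ : ∀ i : Fin m, θ (Fin.natAdd n i) = Fin.castAdd n i := fun i => by simp [hθ]
  have hL : LeftInvOn (Function.invFunOn Φ σ) Φ σ := hinj.leftInvOn_invFunOn
  -- `(x, Φ x) ∘ θ = (Φ x, x)`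
  have hswap : ∀ x : Fin m → ℝ, Fin.append x (Φ x) ∘ θ = Fin.append (Φ x) x := by
    intro x
    funext l
    refine Fin.addCases (fun j => ?_) (fun i => ?_) l
    · simp [hθ₁]
    · simp [hθ₂]
  unfold IsSemialgebraicMapOn at hΦ ⊢
  convert hΦ.image_comp θ using 1
  ext z
  constructor
  · rintro ⟨y, ⟨x, hx, rfl⟩, rfl⟩
    refine ⟨Fin.append x (Φ x), ⟨x, hx, rfl⟩, ?_⟩
    show Fin.append x (Φ x) ∘ θ = _
    rw [hL hx, hswap x]
  · rintro ⟨w, ⟨x, hx, rfl⟩, rfl⟩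
    refine ⟨Φ x, ⟨x, hx, rfl⟩, ?_⟩
    show Fin.append x (Φ x) ∘ θ = _
    rw [hL hx, hswap x]

end Summit.KontsevichZagierPeriods.HermiteRigidity.GenusTwoCycleTransfer

end
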